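import Mathlib
import Literature.Probability.LatticeModels.LebowitzInequality
import Summits.CriticalPhenomena.Ising3DConformalLimit.Theorems.PrecisionLaplacianInverseMFerromagnetPcmOfNc
import HarnessLib

/-!
# Crux `PrecisionLaplacian.InverseMFerromagnet` (stmt-CriticalPhenomena-4798), line `Sketch` —
# stub `stub_nc_of_qpl2` (core chain v2, the analysis link "QPL2 ⇒ NC")

THEOREM-ONLY file (no definitions).  A *system* is a family of nonnegative couplings
`K : Fin m → ℝ` on supports `C i ⊆ Fin n` of at most two sites, and external fields
`f : Fin n → ℝ` are added by enlarging the index type to `Fin m ⊕ Fin n` (couplings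
`Sum.elim K f`, supports `Sum.elim C ({·})`).  Write `⟨·⟩_f` for the corresponding Gibbs
expectation `gksExpect univ (Sum.elim K f) (Sum.elim C ({·}))`, `m_w = ⟨σ_w⟩_f`,
`Cov_f(w,z) = ⟨σ_wσ_z⟩_f − m_w m_z`, and (third cumulant)
`u₃^f(a,z,w) = ⟨σ_aσ_zσ_w⟩_f − m_a⟨σ_zσ_w⟩_f − m_z⟨σ_aσ_w⟩_f − m_w⟨σ_aσ_z⟩_f + 2 m_a m_z m_w`.

* **QPL2** (the hypothesis): for all systems, all fields `0 ≤ g ≤ h`, all sites `a ≠ z` and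
  all `c : Fin n → ℝ`, `(∀ w, 0 ≤ ∑_b c_b Cov_h(b,w)) → ∑_w c_w u₃^g(a,z,w) ≤ 0`.
* **NC** (nested cones, the conclusion): for all systems, all fields `0 ≤ h' ≤ h` and all `c`,
  `(∀ z, 0 ≤ ∑_w c_w Cov_h(w,z)) → (∀ z, 0 ≤ ∑_w c_w Cov_{h'}(w,z))`.

Proof of QPL2 ⇒ NC (one-variable calculus, for each site `z` separately).  Put
`d = h − h' ≥ 0` and follow the affine field path `p(t) = h' + t d` (`p 0 = h'`, `p 1 = h`,
`0 ≤ p t ≤ h` on `[0,1]`).  For `v(t) = ∑_w c_w Cov_{p(t)}(w,z)` one has `v(1) ≥ 0` by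
assumption and `v'(t) = ∑_y d_y T_y(t)` with `T_y(t) = ∑_w c_w u₃^{p(t)}(z,y,w)` (derivative
of a Gibbs expectation in the field couplings).  For `y ≠ z`, `T_y(t) ≤ 0` by QPL2 (premise at
the fixed larger field `h`); for `y = z`, `σ_z² = 1` gives `u₃(z,z,w) = −2 m_z Cov(z,w)`, i.e.
`T_z(t) = −2 m_z(t) v(t)`.  Hence `v' + φ v ≤ 0` on `[0,1]` with the continuous function
`φ(t) = 2 d_z m_z(t)`, so `e^{∫₀ᵗ φ} v` is nonincreasing on `[0,1]` and
`v(0) ≥ e^{∫₀¹ φ} v(1) ≥ 0`.  No matrix inverse and no ODE theory are used.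

In the lemmas below the expectation along the path is abstracted as a function
`E : ℝ → (SpinConfig (Fin n) → ℝ) → ℝ` together with the hypothesis
`hE : ∀ t F, E t F = gksExpect univ (Sum.elim K₀ (h' + t d)) (Sum.elim C ({·})) F`
(instantiated with `fun _ _ => rfl`); this only keeps the statements short.
-/

namespace Summit.CriticalPhenomena.Ising3DConformalLimit.Cruxes.InverseMFerromagnet.PartialCovarianceLadder

open Literature.Probability.LatticeModels Finset Matrix

/-! ## Derivatives of Gibbs expectations along an affine field path -/

/-- `d/dt (Z_t⟨F⟩_t) = Z_t⟨F · ∑_y d_yσ_y⟩_t` along the affine field path `t ↦ h' + t d`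
(elementary calculus on a finite sum of exponentials). [folklore] -/
theorem ncq_hasDerivAt_gksSum (n m : ℕ) (K₀ : Fin m → ℝ) (C : Fin m → Finset (Fin n))
    (h' d : Fin n → ℝ) (F : SpinConfig (Fin n) → ℝ) (t : ℝ) :
    HasDerivAt
      (fun t => gksSum univ (Sum.elim K₀ (fun y => h' y + t * d y)) (Sum.elim C fun x => {x}) F)
      (gksSum univ (Sum.elim K₀ (fun y => h' y + t * d y)) (Sum.elim C fun x => {x})
        (fun ω => F ω * ∑ y, d y * spinAt y ω)) t := by
  have hH : ∀ (t : ℝ) (ω : SpinConfig (Fin n)),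
      gksHamiltonian univ (Sum.elim K₀ (fun y => h' y + t * d y)) (Sum.elim C fun x => {x}) ω =
      (gksHamiltonian univ K₀ C ω + ∑ y, h' y * spinAt y ω) + t * ∑ y, d y * spinAt y ω := by
    intro t ω
    rw [pcmOfNc_hamiltonian_fields, add_assoc, Finset.mul_sum, ← Finset.sum_add_distrib]
    exact congrArg _ (Finset.sum_congr rfl fun y _ => by ring)
  have hfun :
      (fun t => gksSum univ (Sum.elim K₀ (fun y => h' y + t * d y)) (Sum.elim C fun x => {x}) F) =
      fun t => ∑ ω, F ω * Real.exp ((gksHamiltonian univ K₀ C ω + ∑ y, h' y * spinAt y ω) +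
        t * ∑ y, d y * spinAt y ω) := by
    funext t
    simp only [gksSum, gksWeight, hH]
  have hval : gksSum univ (Sum.elim K₀ (fun y => h' y + t * d y)) (Sum.elim C fun x => {x})
      (fun ω => F ω * ∑ y, d y * spinAt y ω) =
      ∑ ω, F ω * (Real.exp ((gksHamiltonian univ K₀ C ω + ∑ y, h' y * spinAt y ω) +
        t * ∑ y, d y * spinAt y ω) * ∑ y, d y * spinAt y ω) := by
    simp only [gksSum, gksWeight, hH]
    exact Finset.sum_congr rfl fun ω _ => by ring
  rw [hfun, hval]
  refine HasDerivAt.fun_sum fun ω _ => ?_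
  have h1 : HasDerivAt (fun t : ℝ => (gksHamiltonian univ K₀ C ω + ∑ y, h' y * spinAt y ω) +
      t * ∑ y, d y * spinAt y ω) (∑ y, d y * spinAt y ω) t := by
    simpa using (hasDerivAt_mul_const (x := t) (∑ y, d y * spinAt y ω)).const_add
      (gksHamiltonian univ K₀ C ω + ∑ y, h' y * spinAt y ω)
  exact h1.exp.const_mul (F ω)

/-- The derivative of `⟨F⟩` along the affine field path `t ↦ h' + t d`, in covariance form:
`d/dt ⟨F⟩_t = ⟨F D⟩_t − ⟨F⟩_t⟨D⟩_t` with `D = ∑_y d_yσ_y`. [folklore] -/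
theorem ncq_hasDerivAt_expect (n m : ℕ) (K₀ : Fin m → ℝ) (C : Fin m → Finset (Fin n))
    (h' d : Fin n → ℝ) (E : ℝ → (SpinConfig (Fin n) → ℝ) → ℝ)
    (hE : ∀ t F, E t F =
      gksExpect univ (Sum.elim K₀ (fun y => h' y + t * d y)) (Sum.elim C fun x => {x}) F)
    (F : SpinConfig (Fin n) → ℝ) (t : ℝ) :
    HasDerivAt (fun t => E t F)
      (E t (fun ω => F ω * ∑ y, d y * spinAt y ω) -
        E t F * E t (fun ω => ∑ y, d y * spinAt y ω)) t := by
  simp only [hE]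
  have hZ := gksSum_one_pos univ (Sum.elim K₀ (fun y => h' y + t * d y))
    (Sum.elim C fun x => ({x} : Finset (Fin n)))
  have h := (ncq_hasDerivAt_gksSum n m K₀ C h' d F t).div
    (ncq_hasDerivAt_gksSum n m K₀ C h' d (fun _ => 1) t) hZ.ne'
  refine h.congr_deriv ?_
  simp only [gksExpect, one_mul]
  field_simp

/-- The derivative of `⟨F⟩` along the affine field path, expanded over the sites:
`d/dt ⟨F⟩_t = ∑_y d_y (⟨F σ_y⟩_t − ⟨F⟩_t⟨σ_y⟩_t)`. [folklore] -/
theorem ncq_hasDerivAt_expect_sum (n m : ℕ) (K₀ : Fin m → ℝ) (C : Fin m → Finset (Fin n))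
    (h' d : Fin n → ℝ) (E : ℝ → (SpinConfig (Fin n) → ℝ) → ℝ)
    (hE : ∀ t F, E t F =
      gksExpect univ (Sum.elim K₀ (fun y => h' y + t * d y)) (Sum.elim C fun x => {x}) F)
    (F : SpinConfig (Fin n) → ℝ) (t : ℝ) :
    HasDerivAt (fun t => E t F)
      (∑ y, d y * (E t (fun ω => F ω * spinAt y ω) - E t F * E t (spinAt y))) t := by
  refine (ncq_hasDerivAt_expect n m K₀ C h' d E hE F t).congr_deriv ?_
  have e1 : E t (fun ω => F ω * ∑ y, d y * spinAt y ω) =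
      ∑ y, d y * E t (fun ω => F ω * spinAt y ω) := by
    have hφ : (fun ω => F ω * ∑ y, d y * spinAt y ω) =
        fun ω => ∑ y, d y * (F ω * spinAt y ω) := by
      funext ω
      rw [Finset.mul_sum]
      exact Finset.sum_congr rfl fun y _ => by ring
    simp only [hE, hφ]
    exact pcmOfNc_gksExpect_sum_smul _ _ _ _ _ _
  have e2 : E t (fun ω => ∑ y, d y * spinAt y ω) = ∑ y, d y * E t (spinAt y) := by
    simp only [hE]
    exact pcmOfNc_gksExpect_sum_smul _ _ _ _ _ _
  rw [e1, e2, Finset.mul_sum, ← Finset.sum_sub_distrib]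
  exact Finset.sum_congr rfl fun y _ => by ring

/-- The derivative of a covariance `Cov_t(w,z) = ⟨σ_wσ_z⟩_t − ⟨σ_w⟩_t⟨σ_z⟩_t` along the affine
field path `t ↦ h' + t d` is `∑_y d_y u₃(z,y,w)`, with the third cumulant
`u₃(z,y,w) = ⟨σ_zσ_yσ_w⟩ − ⟨σ_z⟩⟨σ_yσ_w⟩ − ⟨σ_y⟩⟨σ_zσ_w⟩ − ⟨σ_w⟩⟨σ_zσ_y⟩ + 2⟨σ_z⟩⟨σ_y⟩⟨σ_w⟩`.
[folklore] -/
theorem ncq_hasDerivAt_cov (n m : ℕ) (K₀ : Fin m → ℝ) (C : Fin m → Finset (Fin n))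
    (h' d : Fin n → ℝ) (E : ℝ → (SpinConfig (Fin n) → ℝ) → ℝ)
    (hE : ∀ t F, E t F =
      gksExpect univ (Sum.elim K₀ (fun y => h' y + t * d y)) (Sum.elim C fun x => {x}) F)
    (w z : Fin n) (t : ℝ) :
    HasDerivAt
      (fun t => E t (fun ω => spinAt w ω * spinAt z ω) - E t (spinAt w) * E t (spinAt z))
      (∑ y, d y *
        (E t (fun ω => spinAt z ω * spinAt y ω * spinAt w ω) -
          E t (spinAt z) * E t (fun ω => spinAt y ω * spinAt w ω) -
          E t (spinAt y) * E t (fun ω => spinAt z ω * spinAt w ω) -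
          E t (spinAt w) * E t (fun ω => spinAt z ω * spinAt y ω) +
          2 * E t (spinAt z) * E t (spinAt y) * E t (spinAt w))) t := by
  have hr : ∀ f g : SpinConfig (Fin n) → ℝ, (∀ ω, f ω = g ω) → E t f = E t g :=
    fun f g hfg => by rw [funext hfg]
  refine ((ncq_hasDerivAt_expect_sum n m K₀ C h' d E hE (fun ω => spinAt w ω * spinAt z ω) t).sub
    ((ncq_hasDerivAt_expect_sum n m K₀ C h' d E hE (spinAt w) t).mul
      (ncq_hasDerivAt_expect_sum n m K₀ C h' d E hE (spinAt z) t))).congr_deriv ?_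
  rw [Finset.sum_mul, Finset.mul_sum, ← Finset.sum_add_distrib, ← Finset.sum_sub_distrib]
  refine Finset.sum_congr rfl fun y _ => ?_
  rw [hr (fun ω => spinAt w ω * spinAt z ω * spinAt y ω)
      (fun ω => spinAt z ω * spinAt y ω * spinAt w ω) fun ω => by ring,
    hr (fun ω => spinAt w ω * spinAt z ω) (fun ω => spinAt z ω * spinAt w ω) fun ω => by ring,
    hr (fun ω => spinAt w ω * spinAt y ω) (fun ω => spinAt y ω * spinAt w ω) fun ω => by ring]
  ring

/-- The diagonal third cumulant: since `σ_z² = 1`,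
`u₃(z,z,w) = −2⟨σ_z⟩ (⟨σ_wσ_z⟩ − ⟨σ_w⟩⟨σ_z⟩)`. [folklore] -/
theorem ncq_u3_diag {Λ ι : Type*} [Fintype Λ] [DecidableEq Λ] (s : Finset ι) (K : ι → ℝ)
    (C : ι → Finset Λ) (z w : Λ) :
    gksExpect s K C (fun ω => spinAt z ω * spinAt z ω * spinAt w ω) -
        gksExpect s K C (spinAt z) * gksExpect s K C (fun ω => spinAt z ω * spinAt w ω) -
        gksExpect s K C (spinAt z) * gksExpect s K C (fun ω => spinAt z ω * spinAt w ω) -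
        gksExpect s K C (spinAt w) * gksExpect s K C (fun ω => spinAt z ω * spinAt z ω) +
        2 * gksExpect s K C (spinAt z) * gksExpect s K C (spinAt z) * gksExpect s K C (spinAt w) =
      -2 * gksExpect s K C (spinAt z) *
        (gksExpect s K C (fun ω => spinAt w ω * spinAt z ω) -
          gksExpect s K C (spinAt w) * gksExpect s K C (spinAt z)) := by
  have h1 : (fun ω => spinAt z ω * spinAt z ω * spinAt w ω) = spinAt w :=
    funext fun ω => by rw [spinAt_mul_self, one_mul]
  have h2 : (fun ω => spinAt z ω * spinAt z ω) = fun _ => (1 : ℝ) :=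
    funext fun ω => spinAt_mul_self z ω
  have h3 : gksExpect s K C (fun _ => (1 : ℝ)) = 1 := div_self (gksSum_one_pos s K C).ne'
  have h4 : (fun ω => spinAt z ω * spinAt w ω) = fun ω => spinAt w ω * spinAt z ω :=
    funext fun ω => mul_comm _ _
  rw [h1, h2, h3, h4]
  ring

/-! ## The scalar integrating-factor lemma -/

/-- **Scalar integrating factor.** If `v' + φ v ≤ 0` on `[0,1]` (with `v' = dv/dt` and `φ`
continuous), then `v(1) ≥ 0` forces `v(0) ≥ 0`: the function `e^{∫₀ᵗ φ} v(t)` is nonincreasing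
on `[0,1]`. [folklore] -/
theorem ncq_integrating_factor (v v' φ : ℝ → ℝ) (hv : ∀ t, HasDerivAt v (v' t) t)
    (hφ : Continuous φ) (hineq : ∀ t ∈ Set.Icc (0 : ℝ) 1, v' t + φ t * v t ≤ 0) (h1 : 0 ≤ v 1) :
    0 ≤ v 0 := by
  set Φ : ℝ → ℝ := fun t => ∫ s in (0 : ℝ)..t, φ s with hΦdef
  have hΦ : ∀ t, HasDerivAt Φ (φ t) t := fun t => (hφ.integral_hasStrictDerivAt 0 t).hasDerivAt
  set u : ℝ → ℝ := fun t => Real.exp (Φ t) * v t with hudef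
  have hu : ∀ t, HasDerivAt u (Real.exp (Φ t) * φ t * v t + Real.exp (Φ t) * v' t) t :=
    fun t => (hΦ t).exp.mul (hv t)
  have hanti : AntitoneOn u (Set.Icc (0 : ℝ) 1) :=
    antitoneOn_of_deriv_nonpos (convex_Icc 0 1)
      (fun t _ => (hu t).continuousAt.continuousWithinAt)
      (fun t _ => (hu t).differentiableAt.differentiableWithinAt) fun t ht => by
        rw [interior_Icc] at ht
        rw [(hu t).deriv]
        have hle := hineq t ⟨ht.1.le, ht.2.le⟩
        have hexp := Real.exp_pos (Φ t)
        nlinarith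
  have h01 : u 1 ≤ u 0 :=
    hanti (Set.left_mem_Icc.2 zero_le_one) (Set.right_mem_Icc.2 zero_le_one) zero_le_one
  have hu0 : u 0 = v 0 := by
    simp only [hudef, hΦdef, intervalIntegral.integral_same, Real.exp_zero, one_mul]
  have hu1 : 0 ≤ u 1 := mul_nonneg (Real.exp_pos _).le h1
  linarith

/-! ## QPL2 ⇒ NC -/

/-- **QPL2 ⇒ NC.**  If, for every system with nonnegative couplings on supports of at most two
sites, every pair of fields `0 ≤ g ≤ h`, all sites `a ≠ z` and every `c` in the covariance cone
at `h` (`∀ w, ∑_b c_b Cov_h(b,w) ≥ 0`) one has `∑_w c_w u₃^g(a,z,w) ≤ 0` (QPL2), then the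
covariance cone at `h` is contained in the covariance cone at every smaller field `0 ≤ h' ≤ h`
(NC).  Proof: for each site `z`, `v(t) = ∑_w c_w Cov_{h'+t(h−h')}(w,z)` satisfies
`v' ≤ −2 (h−h')_z m_z(t) v` on `[0,1]` (QPL2 off the diagonal, `u₃(z,z,w) = −2 m_z Cov(z,w)` on
it), and the integrating factor `exp (2 (h−h')_z ∫₀ᵗ m_z)` transports `v(1) ≥ 0` to `v(0) ≥ 0`.
[folklore] -/
theorem stub_nc_of_qpl2 : (∀ (n m : ℕ) (K : Fin m → ℝ) (C : Fin m → Finset (Fin n)), (∀ i, 0 ≤ K i) → (∀ i, (C i).card ≤ 2) → ∀ (h g : Fin n → ℝ), (∀ z, 0 ≤ g z) → (∀ z, g z ≤ h z) → ∀ (a z : Fin n), a ≠ z → ∀ c : Fin n → ℝ, (∀ w : Fin n, 0 ≤ ∑ b, c b * (gksExpect (Finset.univ : Finset (Fin m ⊕ Fin n)) (Sum.elim K h) (Sum.elim C (fun z => ({z} : Finset (Fin n)))) (fun ω => spinAt b ω * spinAt w ω) - gksExpect (Finset.univ : Finset (Fin m ⊕ Fin n)) (Sum.elim K h) (Sum.elim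 C (fun z => ({z} : Finset (Fin n)))) (spinAt b) * gksExpect (Finset.univ : Finset (Fin m ⊕ Fin n)) (Sum.elim K h) (Sum.elim C (fun z => ({z} : Finset (Fin n)))) (spinAt w))) → ∑ w, c w * (gksExpect (Finset.univ : Finset (Fin m ⊕ Fin n)) (Sum.elim K g) (Sum.elim C (fun z => ({z} : Finset (Fin n)))) (fun ω => spinAt a ω * spinAt z ω * spinAt w ω) - gksExpect (Finset.univ : Finset (Fin m ⊕ Fin n)) (Sum.elim K g) (Sum.elim C (fun z => ({z} : Finset (Fin n)))) (spinAt a) * gksExpect (Finset.univ : Finset (Fin m ⊕ Fin n)) (Sum.elim K g) (Sum.elim C (fun z => ({z} : Finset (Fin n)))) (fun ω => spinAt z ω * spinAt w ω) - gksExpect (Finset.univ : Finset (Fin m ⊕ Fin n)) (Sum.elim K g) (Sum.elim C (fun z => ({z} : Finset (Fin n)))) (spinAt z) * gksExpect (Finset.univ : Finset (Fin m ⊕ Fin n)) (Sum.elim K g) (Sum.elim C (fun z => ({z} : Finset (Fin n)))) (fun ω => spinAt a ω * spinAt w ω) - gksExpect (Finset.univ : Finset (Fin m ⊕ Fin n))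 (Sum.elim K g) (Sum.elim C (fun z => ({z} : Finset (Fin n)))) (spinAt w) * gksExpect (Finset.univ : Finset (Fin m ⊕ Fin n)) (Sum.elim K g) (Sum.elim C (fun z => ({z} : Finset (Fin n)))) (fun ω => spinAt a ω * spinAt z ω) + 2 * gksExpect (Finset.univ : Finset (Fin m ⊕ Fin n)) (Sum.elim K g) (Sum.elim C (fun z => ({z} : Finset (Fin n)))) (spinAt a) * gksExpect (Finset.univ : Finset (Fin m ⊕ Fin n)) (Sum.elim K g) (Sum.elim C (fun z => ({z} : Finset (Fin n)))) (spinAt z) * gksExpect (Finset.univ : Finset (Fin m ⊕ Fin n)) (Sum.elim K g) (Sum.elim C (fun z => ({z} : Finset (Fin n)))) (spinAt w)) ≤ 0) → (∀ (n m : ℕ) (K : Fin m → ℝ) (C : Fin m → Finset (Fin n)), (∀ i, 0 ≤ K i) → (∀ i, (C i).card ≤ 2) → ∀ (h h' : Fin n → ℝ), (∀ z, 0 ≤ h' z) → (∀ z, h' z ≤ h z) → ∀ c : Fin n → ℝ, (∀ z : Fin n, 0 ≤ ∑ w, c w * (gksExpect (Finset.univ : Finset (Fin m ⊕ Fin n))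 (Sum.elim K h) (Sum.elim C (fun z => ({z} : Finset (Fin n)))) (fun ω => spinAt w ω * spinAt z ω) - gksExpect (Finset.univ : Finset (Fin m ⊕ Fin n)) (Sum.elim K h) (Sum.elim C (fun z => ({z} : Finset (Fin n)))) (spinAt w) * gksExpect (Finset.univ : Finset (Fin m ⊕ Fin n)) (Sum.elim K h) (Sum.elim C (fun z => ({z} : Finset (Fin n)))) (spinAt z))) → (∀ z : Fin n, 0 ≤ ∑ w, c w * (gksExpect (Finset.univ : Finset (Fin m ⊕ Fin n)) (Sum.elim K h') (Sum.elim C (fun z => ({z} : Finset (Fin n)))) (fun ω => spinAt w ω * spinAt z ω) - gksExpect (Finset.univ : Finset (Fin m ⊕ Fin n)) (Sum.elim K h') (Sum.elim C (fun z => ({z} : Finset (Fin n)))) (spinAt w) * gksExpect (Finset.univ : Finset (Fin m ⊕ Fin n)) (Sum.elim K h') (Sum.elim C (fun z => ({z} : Finset (Fin n)))) (spinAt z)))) := by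
  intro hQ n m K C hK hC h h' hh'0 hh'le c hc z
  -- the direction `d = h - h'`; the affine field path is `t ↦ h' + t • d`
  set d : Fin n → ℝ := fun y => h y - h' y with hddef
  have hd0 : ∀ y, 0 ≤ d y := fun y => sub_nonneg.2 (hh'le y)
  have hp0 : ∀ t : ℝ, 0 ≤ t → ∀ y, 0 ≤ h' y + t * d y :=
    fun t ht y => add_nonneg (hh'0 y) (mul_nonneg ht (hd0 y))
  have hp1 : ∀ t : ℝ, t ≤ 1 → ∀ y, h' y + t * d y ≤ h y := by
    intro t ht y
    have h1 := mul_le_of_le_one_left (hd0 y) ht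
    have h2 : h' y + d y = h y := by
      simp only [hddef]
      ring
    linarith
  -- the expectation along the path, and `v t = ∑_w c_w Cov_t(w,z)`,
  -- `T t y = ∑_w c_w u₃^t(z,y,w)`, `v' t = ∑_y d_y T t y`, `φ t = 2 d_z m_z(t)`
  set E : ℝ → (SpinConfig (Fin n) → ℝ) → ℝ := fun t F =>
    gksExpect univ (Sum.elim K (fun y => h' y + t * d y)) (Sum.elim C fun x => {x}) F with hEdef
  have hE : ∀ t F, E t F =
      gksExpect univ (Sum.elim K (fun y => h' y + t * d y)) (Sum.elim C fun x => {x}) F :=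
    fun _ _ => rfl
  set v : ℝ → ℝ := fun t => ∑ w, c w *
    (E t (fun ω => spinAt w ω * spinAt z ω) - E t (spinAt w) * E t (spinAt z)) with hvdef
  set T : ℝ → Fin n → ℝ := fun t y => ∑ w, c w *
    (E t (fun ω => spinAt z ω * spinAt y ω * spinAt w ω) -
      E t (spinAt z) * E t (fun ω => spinAt y ω * spinAt w ω) -
      E t (spinAt y) * E t (fun ω => spinAt z ω * spinAt w ω) -
      E t (spinAt w) * E t (fun ω => spinAt z ω * spinAt y ω) +
      2 * E t (spinAt z) * E t (spinAt y) * E t (spinAt w)) with hTdef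
  set v' : ℝ → ℝ := fun t => ∑ y, d y * T t y with hv'def
  set φ : ℝ → ℝ := fun t => 2 * d z * E t (spinAt z) with hφdef
  -- `v' = dv/dt`
  have hv : ∀ t, HasDerivAt v (v' t) t := by
    intro t
    rw [hvdef, hv'def]
    refine (HasDerivAt.fun_sum fun w _ =>
      (ncq_hasDerivAt_cov n m K C h' d E hE w z t).const_mul (c w)).congr_deriv ?_
    simp only [hTdef, Finset.mul_sum]
    rw [Finset.sum_comm]
    exact Finset.sum_congr rfl fun y _ => Finset.sum_congr rfl fun w _ => by ring
  -- `φ` is continuous (the magnetisation is differentiable along the path)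
  have hφc : Continuous φ := by
    have hdiff : Differentiable ℝ (fun t => E t (spinAt z)) := fun t =>
      (ncq_hasDerivAt_expect n m K C h' d E hE (spinAt z) t).differentiableAt
    rw [hφdef]
    exact continuous_const.mul hdiff.continuous
  -- the differential inequality `v' + φ v ≤ 0` on `[0,1]`
  have hineq : ∀ t ∈ Set.Icc (0 : ℝ) 1, v' t + φ t * v t ≤ 0 := by
    rintro t ⟨ht0, ht1⟩
    have hsplit : v' t = d z * T t z + ∑ y ∈ univ.erase z, d y * T t y := by
      simp only [hv'def]
      exact (Finset.add_sum_erase _ _ (Finset.mem_univ z)).symm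
    -- diagonal term: `T t z = -2 m_z(t) v(t)`
    have hTz : T t z = -2 * E t (spinAt z) * v t := by
      simp only [hTdef, hvdef, hEdef]
      rw [Finset.mul_sum]
      refine Finset.sum_congr rfl fun w _ => ?_
      rw [ncq_u3_diag]
      ring
    -- off-diagonal terms: `T t y ≤ 0` by QPL2 at the pair `(z, y)` and the fields `p t ≤ h`
    have hTy : ∀ y, y ≠ z → T t y ≤ 0 := by
      intro y hy
      simp only [hTdef, hEdef]
      exact hQ n m K C hK hC h (fun y => h' y + t * d y) (hp0 t ht0) (hp1 t ht1) z y (Ne.symm hy)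
        c hc
    have hrest : ∑ y ∈ univ.erase z, d y * T t y ≤ 0 :=
      Finset.sum_nonpos fun y hy =>
        mul_nonpos_of_nonneg_of_nonpos (hd0 y) (hTy y (Finset.ne_of_mem_erase hy))
    have hkey : v' t + φ t * v t = ∑ y ∈ univ.erase z, d y * T t y := by
      rw [hsplit, hTz]
      simp only [hφdef]
      ring
    rw [hkey]
    exact hrest
  -- endpoints of the path: `p 1 = h`, `p 0 = h'`
  have hpath1 : (fun y => h' y + (1 : ℝ) * d y) = h := funext fun y => by
    simp only [hddef]
    ring
  have hpath0 : (fun y => h' y + (0 : ℝ) * d y) = h' := funext fun y => by ring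
  have h1 : 0 ≤ v 1 := by
    simp only [hvdef, hEdef, hpath1]
    exact hc z
  have h0 := ncq_integrating_factor v v' φ hv hφc hineq h1
  simp only [hvdef, hEdef, hpath0] at h0
  exact h0

end Summit.CriticalPhenomena.Ising3DConformalLimit.Cruxes.InverseMFerromagnet.PartialCovarianceLadder
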